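import Literature.NumberTheory.EllipticCurves.IsogenyHomProofs
import Literature.NumberTheory.EllipticCurves.IsogenyIdProofs
import HarnessLib

/-!
# `End_{K̄}(E)` is `{0} ∪ {algebraic endomorphisms}`: proof of `mem_geomEndRing_iff`

Sibling file of `Literature.NumberTheory.EllipticCurves.Isogeny` (D-0014 append protocol): it
discharges the named fact `WeierstrassCurve.mem_geomEndRing_iff W` — for an elliptic curve `E`
over `K`, an additive endomorphism of `E(K̄)` lies in the geometric endomorphism ring
`W.geomEndRing = End_{K̄}(E)` (defined in the prelude as the subring of `AddMonoid.End E(K̄)`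
generated by the *algebraic* endomorphisms, those agreeing with a `K̄`-rational map off a finite
set) if and only if it is `0` or algebraic. In Silverman's words (*AEC*, III.§4): `Hom(E₁, E₂)`
is a group and `End(E) = Hom(E, E)` is a ring under addition and composition; in the prelude's
encoding this says that `{0} ∪ {algebraic additive endomorphisms}` is closed under sums,
negatives and composition, so that the subring closure adds only `0`.

## Contents

* `Literature.NumberTheory.EllipticCurves.RatFrac.exists_hasValue_eval`: substituting formal fractions `X, Y` into a two-variable
  polynomial `p` gives a formal fraction whose value at `v` is `p(x, y)` whenever `X, Y` have the
  values `x, y` at `v` (induction on `p`, with the `HasValue` calculus of `IsogenyHomProofs`).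
* `Literature.NumberTheory.EllipticCurves.AddMonoidHom.finite_preimage_of_finite_ker`: an additive map with finite kernel has finite
  fibres, hence pulls finite sets back to finite sets.
* `WeierstrassCurve.IsAlgebraicOn.comp`: the composite of algebraic additive maps is algebraic
  (substitute the fractions of the first map into those of the second; the exceptional set is
  contained in `S_g ∪ g⁻¹(S_f)`, finite because `g` has finite kernel, `IsAlgebraicOn.finite_ker`).
* `WeierstrassCurve.add_eq_zero_or_isAlgebraicOn`: the sum of two algebraic additive maps is `0`
  or algebraic — the argument of `Isogeny.add_toAddMonoidHom_eq_zero_or_isAlgebraicOn`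
  (`IsogenyHomProofs`: chord formula off a finite set, or `x(fP) = x(gP)` generically and then
  `f = -g` or `f = g`, tangent formula or `2f = 0`), which uses only algebraicity and additivity
  of the two isogenies and is repeated here for additive maps that need not be defined over `K`.
* `WeierstrassCurve.mem_geomEndRing_iff_holds : W.mem_geomEndRing_iff` by induction on the
  subring closure.

## References

* [SilvermanAEC2009] J. H. Silverman, *The Arithmetic of Elliptic Curves*, 2nd ed., GTM 106,
  Springer 2009: III.§4, the paragraph introducing `Hom(E₁, E₂)` and `End(E)` before
  Example III.4.1 ("`End(E) = Hom(E, E)` … is a ring … multiplication is given by composition"),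
  Thm. III.4.8; III.2.3 (group law algorithm); I.§3 (composition of rational maps).

## Design choices

* `noncomputable section`, `open scoped Classical`, `K : Type u`, dot-notation extensions in
  `namespace WeierstrassCurve`, generic lemmas in `namespace Literature`, as in `IsogenyHomProofs`.
* No new definitions: the substituted fraction is produced existentially
  (`exists_hasValue_eval`), which is all that `IsAlgebraicOn` (an existential) requires.
-/

noncomputable section

open scoped Classical

universe u

namespace Literature.NumberTheory.EllipticCurves

namespace RatFrac

variable {F : Type*} [Field F]

/-- **Substitution of formal fractions into a polynomial.** For `p ∈ F[x, y]` and formal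
fractions `X, Y` there is a formal fraction `R` such that `R` has the value `p(x, y)` at every
point `v` at which `X, Y` have the values `x, y`. (Induction on `p`: constants, sums, and
multiplication by a variable, via `hasValue_const`, `HasValue.add`, `HasValue.mul`.)
Silverman, *AEC*, I.§3 (composition of rational maps). [folklore] -/
theorem exists_hasValue_eval (p : MvPolynomial (Fin 2) F) (X Y : RatFrac F) :
    ∃ R : RatFrac F, ∀ (v : Fin 2 → F) (x y : F), X.HasValue v x → Y.HasValue v y →
      R.HasValue v (MvPolynomial.eval ![x, y] p) := by
  induction p using MvPolynomial.induction_on with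
  | C a =>
    exact ⟨const a, fun v x y _ _ ↦ by simpa only [MvPolynomial.eval_C] using hasValue_const a⟩
  | add p q hp hq =>
    obtain ⟨R, hR⟩ := hp
    obtain ⟨S, hS⟩ := hq
    exact ⟨R.add S, fun v x y hx hy ↦ by
      simpa only [map_add] using (hR v x y hx hy).add (hS v x y hx hy)⟩
  | mul_X p i hp =>
    obtain ⟨R, hR⟩ := hp
    fin_cases i
    · exact ⟨R.mul X, fun v x y hx hy ↦
        ((hR v x y hx hy).mul hx).congr (by simp [MvPolynomial.eval_X])⟩
    · exact ⟨R.mul Y, fun v x y hx hy ↦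
        ((hR v x y hx hy).mul hy).congr (by simp [MvPolynomial.eval_X])⟩

end RatFrac

/-- An additive map with finite kernel pulls finite sets back to finite sets: each non-empty
fibre is a translate of the kernel. [folklore] -/
theorem AddMonoidHom.finite_preimage_of_finite_ker {G H : Type*} [AddCommGroup G]
    [AddCommGroup H] (g : G →+ H) (hker : (g.ker : Set G).Finite) {S : Set H} (hS : S.Finite) :
    (g ⁻¹' S).Finite := by
  have hS' : g ⁻¹' S = ⋃ s ∈ S, g ⁻¹' {s} := by
    ext a
    simp
  rw [hS']
  refine hS.biUnion fun s _ ↦ ?_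
  by_cases hs : ∃ a, g a = s
  · obtain ⟨a, rfl⟩ := hs
    have hfib : g ⁻¹' {g a} = (fun k ↦ a + k) '' (g.ker : Set G) := by
      ext b
      simp only [Set.mem_preimage, Set.mem_singleton_iff, Set.mem_image, SetLike.mem_coe,
        AddMonoidHom.mem_ker]
      constructor
      · intro h
        exact ⟨b - a, by rw [map_sub, h, sub_self], by abel⟩
      · rintro ⟨k, hk, rfl⟩
        rw [map_add, hk, add_zero]
    rw [hfib]
    exact hker.image _
  · have hemp : g ⁻¹' {s} = ∅ := by
      ext b
      simp only [Set.mem_preimage, Set.mem_singleton_iff, Set.mem_empty_iff_false, iff_false]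
      exact fun h ↦ hs ⟨b, h⟩
    rw [hemp]
    exact Set.finite_empty

end Literature.NumberTheory.EllipticCurves

namespace WeierstrassCurve

open geomPoints Literature.NumberTheory.EllipticCurves

variable {K : Type u} [Field K] {W W' W'' : WeierstrassCurve K}

/-! ## Composites of algebraic maps -/

/-- **The composite of algebraic additive maps is algebraic.** If `g : E(K̄) → E'(K̄)` agrees with
`(P₁/Q₁, P₂/Q₂)` off `S_g` and `f : E'(K̄) → E''(K̄)` with `(P₁'/Q₁', P₂'/Q₂')` off `S_f`, then
`f ∘ g` agrees with the substituted fractions `(P₁'(P₁/Q₁, P₂/Q₂)/Q₁'(…), P₂'(…)/Q₂'(…))`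
(`RatFrac.exists_hasValue_eval`) off `S_g ∪ g⁻¹(S_f)`, which is finite because `g`, being
algebraic, has finite kernel (`IsAlgebraicOn.finite_ker`) and hence finite fibres.
Silverman, *AEC*, III.§4 (`End(E)` is a ring under composition), I.§3. [folklore] -/
theorem IsAlgebraicOn.comp {f : W'.geomPoints →+ W''.geomPoints} {g : W.geomPoints →+ W'.geomPoints}
    (hf : IsAlgebraicOn W' W'' f) (hg : IsAlgebraicOn W W' g) :
    IsAlgebraicOn W W'' fun P ↦ f (g P) := by
  have hker := hg.finite_ker
  obtain ⟨P₁, Q₁, P₂, Q₂, hSg⟩ := hg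
  obtain ⟨P₁', Q₁', P₂', Q₂', hSf⟩ := hf
  obtain ⟨R₁, hR₁⟩ := RatFrac.exists_hasValue_eval P₁' ⟨P₁, Q₁⟩ ⟨P₂, Q₂⟩
  obtain ⟨S₁, hS₁⟩ := RatFrac.exists_hasValue_eval Q₁' ⟨P₁, Q₁⟩ ⟨P₂, Q₂⟩
  obtain ⟨R₂, hR₂⟩ := RatFrac.exists_hasValue_eval P₂' ⟨P₁, Q₁⟩ ⟨P₂, Q₂⟩
  obtain ⟨S₂, hS₂⟩ := RatFrac.exists_hasValue_eval Q₂' ⟨P₁, Q₁⟩ ⟨P₂, Q₂⟩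
  refine ⟨(R₁.div S₁).num, (R₁.div S₁).den, (R₂.div S₂).num, (R₂.div S₂).den,
    (hSg.union (AddMonoidHom.finite_preimage_of_finite_ker g hker hSf)).subset fun P hP ↦ ?_⟩
  by_contra hgood
  simp only [Set.mem_union, Set.mem_setOf_eq, Set.mem_preimage, not_or, not_not] at hgood
  obtain ⟨hAg, hAf⟩ := hgood
  refine hP ?_
  obtain ⟨hP0, x, y, h, hgP, hx, hy⟩ := hAg.exists_hasValue
  obtain ⟨-, x', y', h', hfP, hx', hy'⟩ := hAf.exists_hasValue
  have hxy : xy (g P) = ![x, y] := by rw [hgP, xy_some]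
  rw [hxy] at hx' hy'
  have h1 : (R₁.div S₁).HasValue (xy P) x' :=
    ((hR₁ _ _ _ hx hy).div (hS₁ _ _ _ hx hy) hx'.1).congr hx'.eq_div.symm
  have h2 : (R₂.div S₂).HasValue (xy P) y' :=
    ((hR₂ _ _ _ hx hy).div (hS₂ _ _ _ hx hy) hy'.1).congr hy'.eq_div.symm
  exact agreesWithRationalMapAt_of_hasValue hP0 (h := h') hfP h1 h2

/-! ## Sums of algebraic additive maps -/

/-- **The sum of two algebraic additive maps is zero or algebraic.** This is the argument of
`Isogeny.add_toAddMonoidHom_eq_zero_or_isAlgebraicOn` (`IsogenyHomProofs`), which uses only the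
algebraicity and additivity of the two maps, for additive maps `f, g : E(K̄) → E'(K̄)` that need
not be defined over `K`: if `x(fP) ≠ x(gP)` off a finite set, the chord formula exhibits `f + g`
as a rational map; otherwise `x(fP) = x(gP)` at infinitely many hence (finitely many zeros) at
all good `P`, so `fP = ±gP`; comparing `y`-coordinates, `f = -g` off a finite set (so
`f + g = 0`) or `f = g`, and then `f + f` is given by the tangent formula off the points with
`fP ∈ E'[2]`, unless those are infinitely many, when `2fP = O` generically and `f + f = 0`.
Silverman, *AEC*, III.§4 ("(III.3.6) implies that `φ + ψ` is a morphism"), III.2.3.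
[cite: SilvermanAEC2009, III.§4 (Hom(E₁, E₂) is a group)] -/
theorem add_eq_zero_or_isAlgebraicOn [W.IsElliptic] {f g : W.geomPoints →+ W'.geomPoints}
    (hf : IsAlgebraicOn W W' f) (hg : IsAlgebraicOn W W' g) :
    f + g = 0 ∨ IsAlgebraicOn W W' ⇑(f + g) := by
  obtain ⟨P₁, Q₁, P₂, Q₂, hSφ⟩ := hf
  obtain ⟨P₁', Q₁', P₂', Q₂', hSψ⟩ := hg
  set S : Set W.geomPoints := {P | ¬AgreesWithRationalMapAt W W' P₁ Q₁ P₂ Q₂ f P} ∪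
    {P | ¬AgreesWithRationalMapAt W W' P₁' Q₁' P₂' Q₂' g P} with hS_def
  have hS : S.Finite := hSφ.union hSψ
  have hgood : ∀ P ∉ S, AgreesWithRationalMapAt W W' P₁ Q₁ P₂ Q₂ f P ∧
      AgreesWithRationalMapAt W W' P₁' Q₁' P₂' Q₂' g P := fun P hP ↦ by
    simp only [hS_def, Set.mem_union, Set.mem_setOf_eq, not_or, not_not] at hP
    exact hP
  have hne0 : ∀ P ∉ S, P ≠ 0 := fun P hP ↦ (agreesWithRationalMapAt_iff.mp (hgood P hP).1).1
  -- from an infinite zero set off `S` to vanishing at all `P ∉ S`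
  have hall : ∀ q : MvPolynomial (Fin 2) (AlgebraicClosure K),
      ¬{P | P ∉ S ∧ MvPolynomial.eval (xy P) q = 0}.Finite →
        ∀ P ∉ S, MvPolynomial.eval (xy P) q = 0 := fun q hq P hP ↦
    eval_xy_eq_zero_of_infinite (Set.Infinite.mono (fun Q hQ ↦ ⟨hne0 Q hQ.1, hQ.2⟩) hq) (hne0 P hP)
  -- the finite bad sets of the chord / tangent lemmas
  have hbad : ∀ q : MvPolynomial (Fin 2) (AlgebraicClosure K),
      {P | P ∉ S ∧ MvPolynomial.eval (xy P) q = 0}.Finite →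
        {P : W.geomPoints | ¬(AgreesWithRationalMapAt W W' P₁ Q₁ P₂ Q₂ f P ∧
          AgreesWithRationalMapAt W W' P₁' Q₁' P₂' Q₂' g P ∧
          MvPolynomial.eval (xy P) q ≠ 0)}.Finite := fun q hq ↦ by
    refine (hS.union hq).subset fun P hP ↦ ?_
    by_cases hPS : P ∈ S
    · exact Or.inl hPS
    · refine Or.inr ⟨hPS, ?_⟩
      by_contra hne
      exact hP ⟨(hgood P hPS).1, (hgood P hPS).2, hne⟩
  by_cases hZ : {P | P ∉ S ∧ MvPolynomial.eval (xy P) (P₁ * Q₁' - P₁' * Q₁) = 0}.Finite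
  · -- Case 1: the chord formula off a finite set
    exact Or.inr (isAlgebraicOn_add_of_finite (hbad _ hZ))
  -- Case 2: `x(f P) = x(g P)` for all `P ∉ S`
  have hx := hall _ hZ
  have hdec : ∀ P ∉ S, ∃ (x₁ y₁ y₂ : AlgebraicClosure K)
      (h₁ : (W'.baseChange (AlgebraicClosure K)).toAffine.Nonsingular x₁ y₁)
      (h₂ : (W'.baseChange (AlgebraicClosure K)).toAffine.Nonsingular x₁ y₂),
      f P = (Affine.Point.some x₁ y₁ h₁ : W'.geomPoints) ∧
      g P = (Affine.Point.some x₁ y₂ h₂ : W'.geomPoints) ∧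
      RatFrac.HasValue ⟨P₁, Q₁⟩ (xy P) x₁ ∧ RatFrac.HasValue ⟨P₂, Q₂⟩ (xy P) y₁ ∧
      RatFrac.HasValue ⟨P₂', Q₂'⟩ (xy P) y₂ := by
    intro P hPS
    obtain ⟨hAφ, hAψ⟩ := hgood P hPS
    obtain ⟨hP0, x₁, y₁, h₁, hf, hx₁, hy₁⟩ := hAφ.exists_hasValue
    obtain ⟨-, x₂, y₂, h₂, hg, hx₂, hy₂⟩ := hAψ.exists_hasValue
    have hxx : x₁ = x₂ := by
      have e := hx P hPS
      have e1 := hx₁.2; have e2 := hx₂.2; simp only at e1 e2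
      simp only [map_sub, map_mul, e1, e2] at e
      have h3 : (x₁ - x₂) * (MvPolynomial.eval (xy P) Q₁ * MvPolynomial.eval (xy P) Q₁') = 0 := by
        linear_combination e
      exact sub_eq_zero.mp ((mul_eq_zero.mp h3).resolve_right (mul_ne_zero hx₁.1 hx₂.1))
    subst hxx
    exact ⟨x₁, y₁, y₂, h₁, h₂, hf, hg, hx₁, hy₁, hy₂⟩
  by_cases hZ₂ : {P | P ∉ S ∧ MvPolynomial.eval (xy P) (P₂ * Q₂' - P₂' * Q₂) = 0}.Finite
  · -- `f P = -g P` off the finite set `S ∪ Z₂`, so `f + g = 0`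
    refine Or.inl (Literature.NumberTheory.EllipticCurves.AddMonoidHom.eq_of_eqOn_compl_finite (hS.union hZ₂) fun P hP ↦ ?_)
    simp only [Set.mem_union, Set.mem_setOf_eq, not_or, not_and] at hP
    obtain ⟨hPS, hP2⟩ := hP
    obtain ⟨x₁, y₁, y₂, h₁, h₂, hf, hg, hx₁, hy₁, hy₂⟩ := hdec P hPS
    have hyy : y₁ ≠ y₂ := by
      intro he
      apply hP2 hPS
      have e1 := hy₁.2; have e2 := hy₂.2; simp only at e1 e2
      simp only [map_sub, map_mul, e1, e2, he]
      ring
    have hneg : y₁ = (W'.baseChange (AlgebraicClosure K)).toAffine.negY x₁ y₂ :=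
      (Affine.Y_eq_of_X_eq h₁.1 h₂.1 rfl).resolve_left hyy
    rw [AddMonoidHom.add_apply, AddMonoidHom.zero_apply, hf, hg]
    exact Affine.Point.add_of_Y_eq rfl hneg
  -- `f = g` off `S`, hence everywhere
  have hy := hall _ hZ₂
  have heq : f = g := by
    refine Literature.NumberTheory.EllipticCurves.AddMonoidHom.eq_of_eqOn_compl_finite hS fun P hPS ↦ ?_
    obtain ⟨x₁, y₁, y₂, h₁, h₂, hf, hg, hx₁, hy₁, hy₂⟩ := hdec P hPS
    have hyy : y₁ = y₂ := by
      have e := hy P hPS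
      have e1 := hy₁.2; have e2 := hy₂.2; simp only at e1 e2
      simp only [map_sub, map_mul, e1, e2] at e
      have h3 : (y₁ - y₂) * (MvPolynomial.eval (xy P) Q₂ * MvPolynomial.eval (xy P) Q₂') = 0 := by
        linear_combination e
      exact sub_eq_zero.mp ((mul_eq_zero.mp h3).resolve_right (mul_ne_zero hy₁.1 hy₂.1))
    subst hyy
    rw [hf, hg]
  rw [← heq]
  -- doubling: tangent formula off the points with `f P ∈ E'[2]`
  set gd : MvPolynomial (Fin 2) (AlgebraicClosure K) := 2 * P₂ * Q₁ +
    MvPolynomial.C ((W'.baseChange (AlgebraicClosure K)).a₁) * P₁ * Q₂ +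
    MvPolynomial.C ((W'.baseChange (AlgebraicClosure K)).a₃) * Q₁ * Q₂ with hgd
  by_cases hZ₃ : {P | P ∉ S ∧ MvPolynomial.eval (xy P) gd = 0}.Finite
  · refine Or.inr (isAlgebraicOn_two_mul_of_finite (P₁ := P₁) (Q₁ := Q₁) (P₂ := P₂) (Q₂ := Q₂)
      ((hbad gd hZ₃).subset fun P hP hP' ↦ hP ⟨hP'.1, hP'.2.2⟩))
  -- `2 f P = O` off `S`, so `f + f = 0`
  have hd := hall _ hZ₃
  refine Or.inl (Literature.NumberTheory.EllipticCurves.AddMonoidHom.eq_of_eqOn_compl_finite hS fun P hPS ↦ ?_)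
  obtain ⟨x₁, y₁, y₂, h₁, h₂, hf, -, hx₁, hy₁, -⟩ := hdec P hPS
  have hyy : y₁ = (W'.baseChange (AlgebraicClosure K)).toAffine.negY x₁ y₁ := by
    have e := hd P hPS
    have e1 := hx₁.2; have e2 := hy₁.2; simp only at e1 e2
    simp only [hgd, map_add, map_mul, MvPolynomial.eval_C, e1, e2, map_ofNat] at e
    have h3 : (2 * y₁ + (W'.baseChange (AlgebraicClosure K)).a₁ * x₁ +
        (W'.baseChange (AlgebraicClosure K)).a₃) *
        (MvPolynomial.eval (xy P) Q₁ * MvPolynomial.eval (xy P) Q₂) = 0 := by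
      linear_combination e
    have h4 := (mul_eq_zero.mp h3).resolve_right (mul_ne_zero hx₁.1 hy₁.1)
    simp only [Affine.negY]
    linear_combination h4
  rw [AddMonoidHom.add_apply, AddMonoidHom.zero_apply, hf]
  exact Affine.Point.add_self_of_Y_eq hyy

/-! ## The named fact -/

variable (W) in
/-- **`End_{K̄}(E) = {0} ∪ {algebraic endomorphisms}`** — discharge of the named fact
`mem_geomEndRing_iff W`: for an elliptic curve `E / K`, an additive endomorphism of `E(K̄)` lies in
the subring `W.geomEndRing` generated by the algebraic endomorphisms iff it is `0` or algebraic,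
because `{0} ∪ {algebraic}` contains `1` (the tree's `isAlgebraicOn_id`, `IsogenyIdProofs`) and
is closed under sums
(`add_eq_zero_or_isAlgebraicOn`), negatives (`IsAlgebraicOn.neg`) and composition
(`IsAlgebraicOn.comp`). Silverman, *AEC*, III.§4: "`Hom(E₁, E₂)` is a group … `End(E) = Hom(E, E)`
is a ring … multiplication is given by composition" (before Example III.4.1; Thm. III.4.8).
[cite: SilvermanAEC2009, III.§4 (the ring End(E) = Hom(E, E))] -/
theorem mem_geomEndRing_iff_holds : W.mem_geomEndRing_iff := by
  intro _ φ
  refine ⟨fun hφ ↦ ?_, ?_⟩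
  · induction hφ using Subring.closure_induction with
    | mem f hf => exact Or.inr hf
    | zero => exact Or.inl rfl
    | one => exact Or.inr (isAlgebraicOn_id W)
    | add f g _ _ hf hg =>
      rcases hf with rfl | hf
      · rwa [zero_add]
      rcases hg with rfl | hg
      · rw [add_zero]; exact Or.inr hf
      exact add_eq_zero_or_isAlgebraicOn hf hg
    | neg f _ hf =>
      rcases hf with rfl | hf
      · exact Or.inl neg_zero
      · exact Or.inr hf.neg
    | mul f g _ _ hf hg =>
      rcases hf with rfl | hf
      · exact Or.inl (zero_mul g)
      rcases hg with rfl | hg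
      · exact Or.inl (mul_zero f)
      exact Or.inr (hf.comp hg)
  · rintro (rfl | hφ)
    · exact W.geomEndRing.zero_mem
    · exact Subring.subset_closure hφ

end WeierstrassCurve
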